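import Mathlib
import Summits.NavierStokesRegularity.NavierStokesRegularity.Theorems.FilamentSkeletonRssSkeletonJ1RLiaSelfDerivEstimate
import Summits.NavierStokesRegularity.NavierStokesRegularity.Theorems.FilamentSkeletonRssSkeletonJ1RLiaSelfDerivSymm
import Summits.NavierStokesRegularity.NavierStokesRegularity.Theorems.FilamentSkeletonRssSkeletonJ1RLiaSelfDerivSplit
import Summits.NavierStokesRegularity.NavierStokesRegularity.Theorems.FilamentSkeletonRssSkeletonJ1RLiaThirdDerivative
import Summits.NavierStokesRegularity.NavierStokesRegularity.Theorems.FilamentSkeletonRssSkeletonJ1RLiaCurvatureCeiling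
import Summits.NavierStokesRegularity.NavierStokesRegularity.Theorems.FilamentSkeletonRssSkeletonJ1RLiaSelfReference

/-!
# Crux `SkeletonJ1R` (stmt-NavierStokesRegularity-23610) · line `streamline_kantorovich_R` · toward stub F2-d (`LiaDefectDerivBL`, v7), brick S4′ for B1′:
# THE DERIVATIVE LOCAL-INDUCTION ESTIMATE FOR THE LIA REFERENCE — `Ȧ_j` (fixed-σ derivative kernel) against `Λ_e(R)•x_j′τ × x_j‴τ`

Hand `leafhand-ns-filamentskeletonrs-1` (gen 0), `--supports stmt-NavierStokesRegularity-23610 --as helper`.  MODEL rung, NEGATIVE side of the ladder: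
estimates for a HYPOTHETICAL filament-type blow-up skeleton; nothing here is a claim about Navier–Stokes regularity; the stub and the crux stay OPEN.

Derivative analogue of S4 (`…LiaSelfReference.IsLiaReference.selfStrand_sub_lia_le`): brick S3′ (`…LiaSelfDerivEstimate.symmDerivStrand_sub_lia_le`) fed with
the reference data — linear curvature envelope (E2, `curvature_envelope`), tangent oscillation `θ ≥ 2θ₁`, global curvature ceiling
`κm = |β⁻¹|(B_d + (½+|α|)√3ℓ)` (`…LiaCurvatureCeiling`), `Z = x_j‴` everywhere (`…LiaThirdDerivative.hasDerivAt_deriv_deriv_global`) — and with the window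
bounds `‖Z‖ ≤ H`, `‖Z r − Z τ‖ ≤ H′|r − τ|` taken as HYPOTHESES (supplied by `…LiaThirdDerivLipschitz.IsLiaReference.thirdDeriv_window_bounds`), then
transported from the symmetrized integrand `D` back to the FIXED-σ derivative kernel of `Ȧ_j` (the form of B1′) by `…LiaSelfDerivSymm.selfStrand_derivKernel_symm`
and the pointwise identity `…LiaSelfDerivSplit.derivKernel_symm_combine`:
`‖∫ G_e(x_jτ − x_jσ, x_j′σ, x_j′τ) dσ − Λ_e(R)•x_j′τ × Zτ‖ ≤ 2R(8H′+84κ_R H) + 8(κ_R R)²HΛ_e(R) + 72ε₁log(L/R) + 72πκ0/R + (64θ/L + 8κm)π/L`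
(`IsLiaReference.selfDerivStrand_sub_lia_le`).  What remains for F2-d: the Γ-bookkeeping (B1′, template `…LiaDefectSelfBound.selfTerm_bound`).
-/

set_option linter.dupNamespace false -- `NavierStokesRegularity.NavierStokesRegularity` path/namespace repetition is the tree convention

noncomputable section

namespace Summit.NavierStokesRegularity.NavierStokesRegularity.Theorems.SkeletonJ1RFrame

open Set Function Filter Real Topology MeasureTheory
open Literature.Analysis.FluidPDE
open Summit.NavierStokesRegularity.NavierStokesRegularity.Theorems.SkeletonJ1RSlipTools (chord_arc_of_osc)
open Summit.NavierStokesRegularity.NavierStokesRegularity.Theorems.SkeletonJ1RLiaSelf (symmDerivStrand_sub_lia_le derivKernel_symm_combine)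
open scoped InnerProductSpace BigOperators

variable {N : ℕ} {Γ Rb ρ θd : ℝ} {p t : Fin N → EuclideanSpace ℝ (Fin 3)} {γ : Fin N → ℝ} {α : ℝ} {s₀ : Fin N → ℝ}
  {x : Fin N → ℝ → EuclideanSpace ℝ (Fin 3)}

set_option maxHeartbeats 1600000 in
/-- **The derivative local-induction estimate for the LIA reference** (module docstring). [folklore] -/
theorem IsLiaReference.selfDerivStrand_sub_lia_le (hx : IsLiaReference Γ Rb p t γ α s₀ x) (ht : ∀ k, ‖t k‖ = 1) (hθd : 0 < θd)
    (hθd1 : θd ≤ 1) (hgp : ∀ j k, j ≠ k → |inner ℝ (t j) (t k)| ≤ 1 - θd) (hρ : 0 < ρ)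
    (hsep : ∀ j k, j ≠ k → ∀ a b : ℝ, ρ ≤ ‖(p j + a • t j) - (p k + b • t k)‖) (hΓ : 0 < Γ)
    (hℓ : 0 < Rb * Real.sqrt (Γ * Real.log Γ)) (j : Fin N) {θ₁ : ℝ} (hθ₁0 : 0 ≤ θ₁)
    (hθ₁A : ∀ k, k ≠ j → θ₁ ≤ min (Real.sqrt θd / 4) (θd * ρ / (16 * (‖(p j + s₀ j • t j) - (p k + s₀ k • t k)‖ + ρ))))
    (htilt : ∀ σ, ‖deriv (x j) σ - t j‖ ≤ θ₁) {e : ℝ} (he : 0 < e)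
    {τ R L ε₀ ε₁ H H' θ κR κ0 : ℝ} (hR : 0 < R) (hRL : R ≤ L)
    (hε₀ : |(liaCoeff Γ γ j)⁻¹| * ((∑ k ∈ Finset.univ.erase j, |Γ*γ k/(4*Real.pi)| * (2 / (ρ / 2 * Real.sqrt Γ))) +
      (1/2 + |α|) * ‖waistPt Γ p t s₀ j‖) ≤ ε₀)
    (hε₁ : |(liaCoeff Γ γ j)⁻¹| * (1/2 + |α|) ≤ ε₁) (hθ : 2 * θ₁ ≤ θ) (hθ1 : θ ≤ 1)
    (hκR : ε₀ + ε₁ * (|τ| + R) ≤ κR) (hκ0 : ε₀ + ε₁ * |τ| ≤ κ0) (hsmall : κR * R ≤ 1) (hH0 : 0 ≤ H) (hH'0 : 0 ≤ H')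
    (hZH : ∀ r, |r - τ| ≤ R →
      ‖((liaCoeff Γ γ j)⁻¹ * (deriv Real.smoothTransition (1 - (‖x j r‖ ^ 2 / (Rb * Real.sqrt (Γ * Real.log Γ)) ^ 2 + 1 - 2 * (3 / 2 : ℝ))) *
            (-(2 * ⟪x j r, deriv (x j) r⟫_ℝ / (Rb * Real.sqrt (Γ * Real.log Γ)) ^ 2)))) •
          cross (deriv (x j) r) (ambientField Γ p t γ α s₀ j (x j r)) +
        ((liaCoeff Γ γ j)⁻¹ * refCutoff (Rb * Real.sqrt (Γ * Real.log Γ)) (x j r)) •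
          (cross (deriv (x j) r) (fderiv ℝ (ambientField Γ p t γ α s₀ j) (x j r) (deriv (x j) r)) +
            cross (deriv (deriv (x j)) r) (ambientField Γ p t γ α s₀ j (x j r)))‖ ≤ H)
    (hZlip : ∀ r, |r - τ| ≤ R →
      ‖(((liaCoeff Γ γ j)⁻¹ * (deriv Real.smoothTransition (1 - (‖x j r‖ ^ 2 / (Rb * Real.sqrt (Γ * Real.log Γ)) ^ 2 + 1 - 2 * (3 / 2 : ℝ))) *
            (-(2 * ⟪x j r, deriv (x j) r⟫_ℝ / (Rb * Real.sqrt (Γ * Real.log Γ)) ^ 2)))) •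
          cross (deriv (x j) r) (ambientField Γ p t γ α s₀ j (x j r)) +
        ((liaCoeff Γ γ j)⁻¹ * refCutoff (Rb * Real.sqrt (Γ * Real.log Γ)) (x j r)) •
          (cross (deriv (x j) r) (fderiv ℝ (ambientField Γ p t γ α s₀ j) (x j r) (deriv (x j) r)) +
            cross (deriv (deriv (x j)) r) (ambientField Γ p t γ α s₀ j (x j r)))) -
        (((liaCoeff Γ γ j)⁻¹ * (deriv Real.smoothTransition (1 - (‖x j τ‖ ^ 2 / (Rb * Real.sqrt (Γ * Real.log Γ)) ^ 2 + 1 - 2 * (3 / 2 : ℝ))) *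
            (-(2 * ⟪x j τ, deriv (x j) τ⟫_ℝ / (Rb * Real.sqrt (Γ * Real.log Γ)) ^ 2)))) •
          cross (deriv (x j) τ) (ambientField Γ p t γ α s₀ j (x j τ)) +
        ((liaCoeff Γ γ j)⁻¹ * refCutoff (Rb * Real.sqrt (Γ * Real.log Γ)) (x j τ)) •
          (cross (deriv (x j) τ) (fderiv ℝ (ambientField Γ p t γ α s₀ j) (x j τ) (deriv (x j) τ)) +
            cross (deriv (deriv (x j)) τ) (ambientField Γ p t γ α s₀ j (x j τ))))‖ ≤ H' * |r - τ|) :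
    ‖(∫ σ : ℝ, ((-3 * ⟪x j τ - x j σ, deriv (x j) τ⟫_ℝ * ((‖x j τ - x j σ‖ ^ 2 + e ^ 2) ^ (5 / 2 : ℝ))⁻¹) •
          cross (deriv (x j) σ) (x j τ - x j σ) + ((‖x j τ - x j σ‖ ^ 2 + e ^ 2) ^ (3 / 2 : ℝ))⁻¹ • cross (deriv (x j) σ) (deriv (x j) τ))) -
        (Real.arsinh (R / e) - R / Real.sqrt (R ^ 2 + e ^ 2)) • cross (deriv (x j) τ)
          (((liaCoeff Γ γ j)⁻¹ * (deriv Real.smoothTransition (1 - (‖x j τ‖ ^ 2 / (Rb * Real.sqrt (Γ * Real.log Γ)) ^ 2 + 1 - 2 * (3 / 2 : ℝ))) *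
              (-(2 * ⟪x j τ, deriv (x j) τ⟫_ℝ / (Rb * Real.sqrt (Γ * Real.log Γ)) ^ 2)))) •
            cross (deriv (x j) τ) (ambientField Γ p t γ α s₀ j (x j τ)) +
          ((liaCoeff Γ γ j)⁻¹ * refCutoff (Rb * Real.sqrt (Γ * Real.log Γ)) (x j τ)) •
            (cross (deriv (x j) τ) (fderiv ℝ (ambientField Γ p t γ α s₀ j) (x j τ) (deriv (x j) τ)) +
              cross (deriv (deriv (x j)) τ) (ambientField Γ p t γ α s₀ j (x j τ))))‖ ≤
      2 * R * (8 * H' + 84 * (κR * H)) + 8 * (κR * R) ^ 2 * H * (Real.arsinh (R / e) - R / Real.sqrt (R ^ 2 + e ^ 2)) +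
        72 * ε₁ * Real.log (L / R) + 72 * Real.pi * κ0 / R +
        (64 * θ / L + 8 * (|(liaCoeff Γ γ j)⁻¹| * ((∑ k ∈ Finset.univ.erase j, |Γ * γ k / (4 * Real.pi)| * (2 / (ρ / 2 * Real.sqrt Γ))) +
          (1 / 2 + |α|) * (Real.sqrt 3 * (Rb * Real.sqrt (Γ * Real.log Γ)))))) * (Real.pi / L) := by
  obtain ⟨hC2, hunit, h0, h0', hode⟩ := hx j
  set d : ℝ := ρ / 2 * Real.sqrt Γ with hd
  have hd0 : 0 < d := by have := Real.sqrt_pos.2 hΓ; positivity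
  set β := liaCoeff Γ γ j with hβ
  set Q : ℝ := 1/2 + |α| with hQ
  set Bd : ℝ := ∑ k ∈ Finset.univ.erase j, |Γ*γ k/(4*Real.pi)| * (2 / d) with hBd
  set w := waistPt Γ p t s₀ j with hw
  set κm : ℝ := |β⁻¹| * (Bd + Q * (Real.sqrt 3 * (Rb * Real.sqrt (Γ * Real.log Γ)))) with hκm
  -- the third derivative as a function
  set Z : ℝ → EuclideanSpace ℝ (Fin 3) := fun r =>
    ((β⁻¹ * (deriv Real.smoothTransition (1 - (‖x j r‖ ^ 2 / (Rb * Real.sqrt (Γ * Real.log Γ)) ^ 2 + 1 - 2 * (3 / 2 : ℝ))) *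
          (-(2 * ⟪x j r, deriv (x j) r⟫_ℝ / (Rb * Real.sqrt (Γ * Real.log Γ)) ^ 2)))) •
        cross (deriv (x j) r) (ambientField Γ p t γ α s₀ j (x j r)) +
      (β⁻¹ * refCutoff (Rb * Real.sqrt (Γ * Real.log Γ)) (x j r)) •
        (cross (deriv (x j) r) (fderiv ℝ (ambientField Γ p t γ α s₀ j) (x j r) (deriv (x j) r)) +
          cross (deriv (deriv (x j)) r) (ambientField Γ p t γ α s₀ j (x j r)))) with hZdef
  have hZ : ∀ r, |r - τ| ≤ R → HasDerivAt (deriv (deriv (x j))) (Z r) r := fun r _ => hx.hasDerivAt_deriv_deriv_global ht j r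
  have hZH' : ∀ r, |r - τ| ≤ R → ‖Z r‖ ≤ H := fun r hr => hZH r hr
  have hZlip' : ∀ r, |r - τ| ≤ R → ‖Z r - Z τ‖ ≤ H' * |r - τ| := fun r hr => hZlip r hr
  -- partner distance everywhere, envelope, oscillation, ceiling
  have hfar : ∀ σ, ∀ k, k ≠ j → d ^ 2 ≤ ‖x j σ - waistPt Γ p t s₀ k‖ ^ 2 - (inner ℝ (x j σ - waistPt Γ p t s₀ k) (t k)) ^ 2 :=
    fun σ => hx.dist_partner_ge_of_tilt ht hθd hθd1 hgp hρ hsep j hθ₁0 hθ₁A htilt σ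
  have hε₀0 : 0 ≤ ε₀ := le_trans (by positivity) hε₀
  have hε₁0 : 0 ≤ ε₁ := le_trans (by positivity) hε₁
  have henv : ∀ σ, ‖deriv (deriv (x j)) σ‖ ≤ ε₀ + ε₁ * |σ| := by
    intro σ
    have h := hx.curvature_envelope ht j σ hd0 (hfar σ)
    have hsplit : |β⁻¹| * (Bd + Q * (‖w‖ + |σ|)) = |β⁻¹| * (Bd + Q * ‖w‖) + (|β⁻¹| * Q) * |σ| := by ring
    calc ‖deriv (deriv (x j)) σ‖ ≤ |β⁻¹| * (Bd + Q * (‖w‖ + |σ|)) := h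
      _ = |β⁻¹| * (Bd + Q * ‖w‖) + (|β⁻¹| * Q) * |σ| := hsplit
      _ ≤ ε₀ + ε₁ * |σ| := add_le_add hε₀ (mul_le_mul_of_nonneg_right hε₁ (abs_nonneg σ))
  have hosc : ∀ u v, ‖deriv (x j) u - deriv (x j) v‖ ≤ θ := by
    intro u v
    calc ‖deriv (x j) u - deriv (x j) v‖ = ‖(deriv (x j) u - t j) - (deriv (x j) v - t j)‖ := by congr 1; abel
      _ ≤ ‖deriv (x j) u - t j‖ + ‖deriv (x j) v - t j‖ := norm_sub_le _ _
      _ ≤ θ₁ + θ₁ := add_le_add (htilt u) (htilt v)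
      _ ≤ θ := by linarith
  have hκmb : ∀ s, ‖deriv (deriv (x j)) s‖ ≤ κm := fun s =>
    hx.norm_deriv_deriv_le_ceiling ht hθd hθd1 hgp hρ hsep j hθ₁0 hθ₁A htilt hΓ hℓ s
  -- brick S3′
  obtain ⟨hDint, hD⟩ := symmDerivStrand_sub_lia_le hC2 hunit he hR hRL hε₀0 hε₁0 henv hH0 hH'0 hZ hZH' hZlip' hθ1 hosc hκmb hκR hκ0 hsmall
  -- transport to the fixed-σ derivative kernel: ∫G = ∫(G + ∂σf) = ∫D
  have hθ0 : 0 ≤ θ := by linarith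
  have hchord : ∀ u v, (1 / 2 : ℝ) * |u - v| ≤ ‖x j u - x j v‖ := fun u v => by
    have h := chord_arc_of_osc (hC2.of_le (by norm_num)) hunit hosc u v
    have : (1 / 2 : ℝ) * |u - v| ≤ (1 - θ ^ 2 / 2) * |u - v| := mul_le_mul_of_nonneg_right (by nlinarith) (abs_nonneg _)
    exact this.trans h
  have hsymm := selfStrand_derivKernel_symm (q := e ^ 2) (by positivity) hC2 hunit (by norm_num : (0:ℝ) < 1 / 2) hchord hκmb τ (deriv (x j) τ)
  have hcomb : (∫ σ : ℝ, (((-3 * ⟪x j τ - x j σ, deriv (x j) τ⟫_ℝ * ((‖x j τ - x j σ‖ ^ 2 + e ^ 2) ^ (5 / 2 : ℝ))⁻¹) •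
          cross (deriv (x j) σ) (x j τ - x j σ) + ((‖x j τ - x j σ‖ ^ 2 + e ^ 2) ^ (3 / 2 : ℝ))⁻¹ • cross (deriv (x j) σ) (deriv (x j) τ)) +
        ((-3 * ⟪x j τ - x j σ, -deriv (x j) σ⟫_ℝ * ((‖x j τ - x j σ‖ ^ 2 + e ^ 2) ^ (5 / 2 : ℝ))⁻¹) • cross (deriv (x j) σ) (x j τ - x j σ) +
          ((‖x j τ - x j σ‖ ^ 2 + e ^ 2) ^ (3 / 2 : ℝ))⁻¹ • (cross (deriv (x j) σ) (-deriv (x j) σ) + cross (deriv (deriv (x j)) σ) (x j τ - x j σ))))) =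
      ∫ σ : ℝ, ((-3 * ⟪x j τ - x j σ, deriv (x j) τ - deriv (x j) σ⟫_ℝ * ((‖x j τ - x j σ‖ ^ 2 + e ^ 2) ^ (5 / 2 : ℝ))⁻¹) •
          cross (deriv (x j) σ) (x j τ - x j σ) +
        ((‖x j τ - x j σ‖ ^ 2 + e ^ 2) ^ (3 / 2 : ℝ))⁻¹ • (cross (deriv (x j) σ) (deriv (x j) τ - deriv (x j) σ) + cross (deriv (deriv (x j)) σ) (x j τ - x j σ))) := by
    refine integral_congr_ae (Eventually.of_forall fun σ => ?_)
    exact derivKernel_symm_combine _ _ _ _ _ _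
  rw [hsymm, hcomb]
  exact hD

end Summit.NavierStokesRegularity.NavierStokesRegularity.Theorems.SkeletonJ1RFrame

end
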